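import Summits.BirchSwinnertonDyer.Rank1Residual.Additive.RamifiedSevenGenusKatoExpDatumOfLaws
import Summits.BirchSwinnertonDyer.Rank1Residual.Additive.RamifiedSevenGenusKatoExpPadicDatum
import HarnessLib

set_option autoImplicit false

/-!
# `𝒞₇` genus road (crux `EllipticUnitValueSevenOfGZK`, K7r), the (S-D) line, STEP 1: THE CONSTRUCTOR `KatoExpPadicDatum.ofLaws` —
# the 7-ADIC dual-exponential value datum of a pinned frame BUILT from its three load-bearing inputs
# {(e2) `ExpStarCMShape`, (eZ′) the 7-adic ★-value law, (psiK)}; every other field is a TERM or a THEOREM of the tree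

Cell bsd-cm, seat bsd-cm-prr-ty1 g36 (literature-prover); pen D1104 (d) (the (S-D)/(S-★) line of the successor unit; STEP-0 memo
`bsd-cm-prr-ty1/g36/SD-REDUCTION-MEMO.md`).  This file is the 7-ADIC twin of `KatoExpDatum.ofLaws` (`RamifiedSevenGenusKatoExpDatumOfLaws.lean`,
seat g35): the registered stub (S-D) of zp v19 asks for `Nonempty (KatoExpPadicDatum hγ (katoGenusFrameOf …))`, i.e. for the PADIC datum
(`α₀ α₁ : ℤ_[7]`, (eZ′) read through `ι₇`), for which no constructor existed.

## What `ofLaws` takes and what it builds (inhabitation ledger of `KatoExpPadicDatum hγ Φ`, `RamifiedSevenGenusKatoExpPadicDatum.lean` l.77–140)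
ARGUMENTS (the residual NAMED inputs — nothing else is assumed): `ι₇ : ℚ_[7] →+* ℂ` (one exists: `nonempty_padicRingHom_complex`);
(e2) `h2 : Φ.ExpStarCMShape` (Kato 15.14 «`O_K` acts through `K`» for the datum `Φ.𝔏`); (eZ′) `e`, `α₀ α₁ : ℤ_[7]`, `hα`, `n₀`, `hZ` — the
7-adic ★-constants and the value law of `res zOne` at primitive characters for the reading `valOf`, the FIELD letter of `val_zStar` with
`val := Φ.valOf ι₇`, `zStar := res zOne` substituted (Kato Thm. 12.5 (1) with (15.16.1): the crux's research content); (psiK) `b₀ b₁ hψ`.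
BUILT: `ι₇`; `val := Φ.valOf ι₇`; (e1) `val_T := valOf_T_smul`; (e1′) `val_C := valOf_C_smul`; (e2) `val_piK := valOf_piK_of_expStarCM h2`;
(eV) `val_euK := valOf_euK`; `uStar := 1`, `zStar := res zOne`, `uStar_smul_zStar := one_smul`; (art) `artExp := ZpExtension.artinExponent Φ.towerK`,
`art := heckeIdealValue_eq_pow_of_isCoprime`.  NET: (S-D) `Nonempty (KatoExpPadicDatum hγ Φ)` REDUCES, for every pinned frame and every
`ι₇`, to {(e2), (eZ′), (psiK)} — `katoExpPadicCompatShape_of_laws`; 9 of the 15 fields are terms/theorems.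
HONEST LABEL: a constructor from named hypotheses (a definition with a body + `rfl` projections + one corollary); (e2)/(eZ′) are NOT
proved here (road D / crux content), (psiK) is an argument at the abstract frame; no stub is closed; stmt-BirchSwinnertonDyer-19945 OPEN
(5 sorries, zp v19); K2ᶜ-inhabitation NOT advanced beyond the reduction; `X12.CMRamifiedSeven` NOT proved; no summit statement is proved by
this seat; BSD is claimed for no curve.  No `sorry`, no `instance`, no notation, no named fact.

## References
* K. Kato, Astérisque 295 (2004), Prop. 15.9 / (15.9.1) (pp. 258–259), (15.12.1)–(15.12.2) (p. 263), 15.14 (p. 264), (15.16.1) (p. 265),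
  Thm. 12.5 (1) (p. 221). [Kato2004Asterisque]
* S. Bloch, K. Kato (1990), Def. 3.10. [BlochKato1990]
* L. C. Washington (1997), §13.1, Prop. 13.2. [Washington1997]
* J. Neukirch, A. Schmidt, K. Wingberg (2008), XI §1–§2. [NeukirchSchmidtWingberg2008]
* Tree: `KatoExpDatum.ofLaws` (g35), F-A1/F-A2 `RamifiedSevenGenusKatoExpReading{,Values}`, F-B `ZpExtensionArtinExponent`.
-/

noncomputable section

open scoped NumberField TensorProduct
open Field IsDedekindDomain NumberField
open Literature.NumberTheory.GaloisRepresentations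
open Literature.NumberTheory.EllipticCurves
open Literature.NumberTheory.EllipticCurves.Rank1Residual
open Literature.NumberTheory.EllipticCurves.IwasawaAlgebra
open Literature.NumberTheory.EllipticCurves.Kato2004
open Literature.NumberTheory.ComplexMultiplication.EllipticUnits
open Summit.BirchSwinnertonDyer.Rank1Residual

namespace Summit.BirchSwinnertonDyer.Rank1Residual.Additive.GenusSeven

section Frame

variable {W : WeierstrassCurve ℚ} [W.IsElliptic] [W.IsGloballyMinimal] [Fact (Nat.Prime 7)]
  [ContinuousSMul ℤ_[7] (W.tateModule 7)] {K : ZpExtension ℚ 7} {hK : K.IsCyclotomic}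
  {γ : Field.absoluteGaloisGroup ℚ} {I : IwasawaH1Data W 7 K γ}
  {F : GenusFrame} {θu : ∀ n : ℕ, globalUnitsOf (F.layer n)} {d : GenusDatum F θu}

namespace KatoExpPadicDatum

/-- ★ **`KatoExpPadicDatum.ofLaws` — THE INHABITATION CONSTRUCTOR of the 7-adic dual-exponential value datum**: from a complex reading
`ι₇` of `ℚ₇`, the (e2) `𝔏`-law `ExpStarCMShape`, the 7-adic (eZ′) constants `(e, α₀, α₁, n₀)` and ★-value law at `res zOne` for the reading
`valOf` (read through `ι₇`), and the (psiK) integer coordinates of `2ψ` on twists — the datum with `val := valOf Φ ι₇` ((e1), (e1′), (eV)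
THEOREMS), `uStar := 1`, `zStar := res zOne`, and (art) by the Artin exponent.  A definition; the three laws it takes are its only hypotheses.
[cite: Kato2004Asterisque, Prop. 15.9 (15.9.1) (pp. 258–259), Thm. 12.5 (1) (p. 221), (15.12.2) (p. 263), 15.14 (p. 264), (15.16.1) (p. 265)]
[cite: BlochKato1990, Def. 3.10 (p. 359)] [cite: Washington1997, §13.1 and Prop. 13.2] -/
def ofLaws (hγ : K.IsTopGenerator γ) (Φ : PinnedKatoGenusFrame W K hK I d) (ι₇ : ℚ_[7] →+* ℂ)
    (h2 : Φ.ExpStarCMShape)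
    (e : ℕ) (α₀ α₁ : ℤ_[7]) (hα : α₀ ≠ 0 ∨ α₁ ≠ 0) (n₀ : ℕ)
    (hZ : ∀ (n : ℕ), n₀ ≤ n → ∀ (χ : absoluteGaloisGroup Φ.Kcm →ₜ* ℂˣ),
      (∀ σ ∈ Φ.towerK.layerSubgroup (n + 1), χ σ = 1) →
      IsPrimitiveRoot (((χ Φ.γK : ℂˣ)) : ℂ) (7 ^ (n + 1)) →
      ∀ Lf : ℂ → ℂ, CM.IsDepletedHeckeL Φ.ψ χ (7 * (7 * F.d)) Lf →
        (7 : ℂ) ^ e * Φ.valOf ι₇ χ (I.resOver Φ.IK hγ Φ.isTopGenerator_γK Φ.zOne) =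
          (ι₇ (α₀ : ℚ_[7]) + ι₇ (α₁ : ℚ_[7]) * Φ.ιC (algebraMap Φ.Kcm (AlgebraicClosure Φ.Kcm) Φ.sqrtNegSeven)) * Φ.Ω⁻¹ * Lf 1)
    (b₀ b₁ : Ideal (𝓞 Φ.Kcm) → ℤ)
    (hψ : ∀ (𝔟 : Ideal (𝓞 Φ.Kcm)), IsTwist 7 Φ.𝔣 𝔟 →
      2 * CM.heckeCharIdealValue Φ.ψ 𝔟 =
        (b₀ 𝔟 : ℂ) + (b₁ 𝔟 : ℂ) * Φ.ιC (algebraMap Φ.Kcm (AlgebraicClosure Φ.Kcm) Φ.sqrtNegSeven)) :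
    KatoExpPadicDatum hγ Φ where
  ι₇ := ι₇
  val := Φ.valOf ι₇
  val_T := fun χ hχ x => Φ.valOf_T_smul ι₇ χ hχ x
  val_C := fun χ _ c x => Φ.valOf_C_smul ι₇ χ c x
  val_piK := fun χ _ x => Φ.valOf_piK_of_expStarCM h2 ι₇ χ x
  val_euK := fun 𝔟 h𝔟 n χ hχ Lf hLf => Φ.valOf_euK ι₇ 𝔟 h𝔟 n χ hχ Lf hLf
  uStar := 1
  zStar := I.resOver Φ.IK hγ Φ.isTopGenerator_γK Φ.zOne
  uStar_smul_zStar := by rw [Units.val_one, one_smul]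
  e := e
  α₀ := α₀
  α₁ := α₁
  α_ne_zero := hα
  n₀ := n₀
  val_zStar := hZ
  bCoef₀ := b₀
  bCoef₁ := b₁
  psi_eq := hψ
  artExp := ZpExtension.artinExponent Φ.towerK
  art := fun 𝔟 h𝔟 n m hm χ hχ =>
    ZpExtension.heckeIdealValue_eq_pow_of_isCoprime Φ.towerK Φ.isTopGenerator_γK χ hχ (ne_bot_of_isTwist h𝔟)
      (isCoprime_span_seven_of_isTwist h𝔟) hm

variable {hγ : K.IsTopGenerator γ} {Φ : PinnedKatoGenusFrame W K hK I d} {ι₇ : ℚ_[7] →+* ℂ}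
  {h2 : Φ.ExpStarCMShape} {e : ℕ} {α₀ α₁ : ℤ_[7]} {hα : α₀ ≠ 0 ∨ α₁ ≠ 0} {n₀ : ℕ}
  {hZ : ∀ (n : ℕ), n₀ ≤ n → ∀ (χ : absoluteGaloisGroup Φ.Kcm →ₜ* ℂˣ),
      (∀ σ ∈ Φ.towerK.layerSubgroup (n + 1), χ σ = 1) →
      IsPrimitiveRoot (((χ Φ.γK : ℂˣ)) : ℂ) (7 ^ (n + 1)) →
      ∀ Lf : ℂ → ℂ, CM.IsDepletedHeckeL Φ.ψ χ (7 * (7 * F.d)) Lf →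
        (7 : ℂ) ^ e * Φ.valOf ι₇ χ (I.resOver Φ.IK hγ Φ.isTopGenerator_γK Φ.zOne) =
          (ι₇ (α₀ : ℚ_[7]) + ι₇ (α₁ : ℚ_[7]) * Φ.ιC (algebraMap Φ.Kcm (AlgebraicClosure Φ.Kcm) Φ.sqrtNegSeven)) * Φ.Ω⁻¹ * Lf 1}
  {b₀ b₁ : Ideal (𝓞 Φ.Kcm) → ℤ}
  {hψ : ∀ (𝔟 : Ideal (𝓞 Φ.Kcm)), IsTwist 7 Φ.𝔣 𝔟 →
      2 * CM.heckeCharIdealValue Φ.ψ 𝔟 =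
        (b₀ 𝔟 : ℂ) + (b₁ 𝔟 : ℂ) * Φ.ιC (algebraMap Φ.Kcm (AlgebraicClosure Φ.Kcm) Φ.sqrtNegSeven)}

/-- Projection: `ι₇`. [cite: Kato2004Asterisque, Thm. 12.5 (1) (p. 221)] -/
@[simp] theorem ofLaws_ι₇ : (ofLaws hγ Φ ι₇ h2 e α₀ α₁ hα n₀ hZ b₀ b₁ hψ).ι₇ = ι₇ := rfl

/-- Projection: `val = valOf Φ ι₇`. [cite: Kato2004Asterisque, Prop. 15.9 (p. 258)] -/
@[simp] theorem ofLaws_val : (ofLaws hγ Φ ι₇ h2 e α₀ α₁ hα n₀ hZ b₀ b₁ hψ).val = Φ.valOf ι₇ := rfl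

/-- Projection: `uStar = 1`. [cite: Kato2004Asterisque, Thm. 12.5 (1) (p. 221)] -/
@[simp] theorem ofLaws_uStar : (ofLaws hγ Φ ι₇ h2 e α₀ α₁ hα n₀ hZ b₀ b₁ hψ).uStar = 1 := rfl

/-- Projection: `zStar = res zOne`. [cite: Kato2004Asterisque, Thm. 12.5 (1) (p. 221) and 15.14 (p. 264)] -/
@[simp] theorem ofLaws_zStar :
    (ofLaws hγ Φ ι₇ h2 e α₀ α₁ hα n₀ hZ b₀ b₁ hψ).zStar = I.resOver Φ.IK hγ Φ.isTopGenerator_γK Φ.zOne := rfl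

/-- Projection: `e`. [cite: Kato2004Asterisque, (15.16.1) (p. 265)] -/
@[simp] theorem ofLaws_e : (ofLaws hγ Φ ι₇ h2 e α₀ α₁ hα n₀ hZ b₀ b₁ hψ).e = e := rfl

/-- Projection: `α₀`. [cite: Kato2004Asterisque, (15.16.1) (p. 265)] -/
@[simp] theorem ofLaws_α₀ : (ofLaws hγ Φ ι₇ h2 e α₀ α₁ hα n₀ hZ b₀ b₁ hψ).α₀ = α₀ := rfl

/-- Projection: `α₁`. [cite: Kato2004Asterisque, (15.16.1) (p. 265)] -/
@[simp] theorem ofLaws_α₁ : (ofLaws hγ Φ ι₇ h2 e α₀ α₁ hα n₀ hZ b₀ b₁ hψ).α₁ = α₁ := rfl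

/-- Projection: `n₀`. [cite: Kato2004Asterisque, Thm. 12.5 (1) (p. 221)] -/
@[simp] theorem ofLaws_n₀ : (ofLaws hγ Φ ι₇ h2 e α₀ α₁ hα n₀ hZ b₀ b₁ hψ).n₀ = n₀ := rfl

/-- Projection: `bCoef₀`. [cite: Kato2004Asterisque, §15.7 (p. 256)] -/
@[simp] theorem ofLaws_bCoef₀ : (ofLaws hγ Φ ι₇ h2 e α₀ α₁ hα n₀ hZ b₀ b₁ hψ).bCoef₀ = b₀ := rfl

/-- Projection: `bCoef₁`. [cite: Kato2004Asterisque, §15.7 (p. 256)] -/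
@[simp] theorem ofLaws_bCoef₁ : (ofLaws hγ Φ ι₇ h2 e α₀ α₁ hα n₀ hZ b₀ b₁ hψ).bCoef₁ = b₁ := rfl

/-- Projection: `artExp = artinExponent` of the cyclotomic `ℤ₇`-tower of `Kcm`. [cite: Kato2004Asterisque, (15.12.2) (p. 263)] -/
@[simp] theorem ofLaws_artExp :
    (ofLaws hγ Φ ι₇ h2 e α₀ α₁ hα n₀ hZ b₀ b₁ hψ).artExp = ZpExtension.artinExponent Φ.towerK := rfl

/-- The 7-adic norm `N(α) = α₀² + 7α₁²` of the constructed datum. [cite: Kato2004Asterisque, (15.16.1) (p. 265)] -/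
theorem ofLaws_normA : (ofLaws hγ Φ ι₇ h2 e α₀ α₁ hα n₀ hZ b₀ b₁ hψ).normA = α₀ ^ 2 + 7 * α₁ ^ 2 := rfl

/-- The period-position exponent `jα = v₇(α₀² + 7α₁²)` of the constructed datum — the quantity bounded by (S-★).
[cite: Kato2004Asterisque, (15.16.1) (p. 265) and Thm. 12.5 (1) (p. 221)] -/
theorem ofLaws_jα : (ofLaws hγ Φ ι₇ h2 e α₀ α₁ hα n₀ hZ b₀ b₁ hψ).jα = (α₀ ^ 2 + 7 * α₁ ^ 2).valuation := rfl

end KatoExpPadicDatum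

/-- ★ **(S-D) FROM THE THREE LAWS**: the pinned frame ADMITS a 7-adic dual-exponential value datum — `Nonempty (KatoExpPadicDatum hγ Φ)`,
the letter of zp v19's `stub_katoExpPadicDatumSeven` at `Φ := katoGenusFrameOf …` — as soon as (e2) in `𝔏`-form, the 7-adic (eZ′)
★-value law for the reading `valOf`, and (psiK) are supplied. [cite: Kato2004Asterisque, Prop. 15.9 (p. 258), Thm. 12.5 (1) (p. 221), 15.14 (p. 264), (15.16.1) (p. 265)] -/
theorem katoExpPadicCompatShape_of_laws (hγ : K.IsTopGenerator γ) (Φ : PinnedKatoGenusFrame W K hK I d) (ι₇ : ℚ_[7] →+* ℂ)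
    (h2 : Φ.ExpStarCMShape)
    (e : ℕ) (α₀ α₁ : ℤ_[7]) (hα : α₀ ≠ 0 ∨ α₁ ≠ 0) (n₀ : ℕ)
    (hZ : ∀ (n : ℕ), n₀ ≤ n → ∀ (χ : absoluteGaloisGroup Φ.Kcm →ₜ* ℂˣ),
      (∀ σ ∈ Φ.towerK.layerSubgroup (n + 1), χ σ = 1) →
      IsPrimitiveRoot (((χ Φ.γK : ℂˣ)) : ℂ) (7 ^ (n + 1)) →
      ∀ Lf : ℂ → ℂ, CM.IsDepletedHeckeL Φ.ψ χ (7 * (7 * F.d)) Lf →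
        (7 : ℂ) ^ e * Φ.valOf ι₇ χ (I.resOver Φ.IK hγ Φ.isTopGenerator_γK Φ.zOne) =
          (ι₇ (α₀ : ℚ_[7]) + ι₇ (α₁ : ℚ_[7]) * Φ.ιC (algebraMap Φ.Kcm (AlgebraicClosure Φ.Kcm) Φ.sqrtNegSeven)) * Φ.Ω⁻¹ * Lf 1)
    (b₀ b₁ : Ideal (𝓞 Φ.Kcm) → ℤ)
    (hψ : ∀ (𝔟 : Ideal (𝓞 Φ.Kcm)), IsTwist 7 Φ.𝔣 𝔟 →
      2 * CM.heckeCharIdealValue Φ.ψ 𝔟 =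
        (b₀ 𝔟 : ℂ) + (b₁ 𝔟 : ℂ) * Φ.ιC (algebraMap Φ.Kcm (AlgebraicClosure Φ.Kcm) Φ.sqrtNegSeven)) :
    Nonempty (KatoExpPadicDatum hγ Φ) :=
  ⟨KatoExpPadicDatum.ofLaws hγ Φ ι₇ h2 e α₀ α₁ hα n₀ hZ b₀ b₁ hψ⟩

/-- **The ℤ-typed laws are a special case**: integer ★-constants `(α₀, α₁) ∈ ℤ²` with the `KatoExpDatum` letter of the ★-law give the
7-adic datum (`ι₇` is the identity on `ℤ`). [cite: Kato2004Asterisque, (15.16.1) (p. 265)] -/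
theorem katoExpPadicCompatShape_of_intLaws (hγ : K.IsTopGenerator γ) (Φ : PinnedKatoGenusFrame W K hK I d) (ι₇ : ℚ_[7] →+* ℂ)
    (h2 : Φ.ExpStarCMShape)
    (e : ℕ) (α₀ α₁ : ℤ) (hα : α₀ ≠ 0 ∨ α₁ ≠ 0) (n₀ : ℕ)
    (hZ : ∀ (n : ℕ), n₀ ≤ n → ∀ (χ : absoluteGaloisGroup Φ.Kcm →ₜ* ℂˣ),
      (∀ σ ∈ Φ.towerK.layerSubgroup (n + 1), χ σ = 1) →
      IsPrimitiveRoot (((χ Φ.γK : ℂˣ)) : ℂ) (7 ^ (n + 1)) →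
      ∀ Lf : ℂ → ℂ, CM.IsDepletedHeckeL Φ.ψ χ (7 * (7 * F.d)) Lf →
        (7 : ℂ) ^ e * Φ.valOf ι₇ χ (I.resOver Φ.IK hγ Φ.isTopGenerator_γK Φ.zOne) =
          ((α₀ : ℂ) + (α₁ : ℂ) * Φ.ιC (algebraMap Φ.Kcm (AlgebraicClosure Φ.Kcm) Φ.sqrtNegSeven)) * Φ.Ω⁻¹ * Lf 1)
    (b₀ b₁ : Ideal (𝓞 Φ.Kcm) → ℤ)
    (hψ : ∀ (𝔟 : Ideal (𝓞 Φ.Kcm)), IsTwist 7 Φ.𝔣 𝔟 →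
      2 * CM.heckeCharIdealValue Φ.ψ 𝔟 =
        (b₀ 𝔟 : ℂ) + (b₁ 𝔟 : ℂ) * Φ.ιC (algebraMap Φ.Kcm (AlgebraicClosure Φ.Kcm) Φ.sqrtNegSeven)) :
    Nonempty (KatoExpPadicDatum hγ Φ) := by
  have hα' : ((α₀ : ℤ_[7]) ≠ 0) ∨ ((α₁ : ℤ_[7]) ≠ 0) := by
    rcases hα with h | h
    · exact Or.inl (by exact_mod_cast h)
    · exact Or.inr (by exact_mod_cast h)
  refine katoExpPadicCompatShape_of_laws hγ Φ ι₇ h2 e (α₀ : ℤ_[7]) (α₁ : ℤ_[7]) hα' n₀ ?_ b₀ b₁ hψ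
  intro n hn χ hχ hprim Lf hLf
  rw [hZ n hn χ hχ hprim Lf hLf, PadicInt.coe_intCast, PadicInt.coe_intCast, map_intCast, map_intCast]

end Frame

/-! ## §3 (R1″) The constructor at a GENERAL ★-unit `uStar ∈ Λˣ` (pen D1108 (R1″), critic NOTE #14: the research statement (S-D-★′) is the
`hZ` binder below under `∃ uStar e α₀ α₁ (α ≠ 0) n₀`, never the `uStar := 1` letter) -/

section Unit

variable {W : WeierstrassCurve ℚ} [W.IsElliptic] [W.IsGloballyMinimal] [Fact (Nat.Prime 7)]
  [ContinuousSMul ℤ_[7] (W.tateModule 7)] {K : ZpExtension ℚ 7} {hK : K.IsCyclotomic}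
  {γ : Field.absoluteGaloisGroup ℚ} {I : IwasawaH1Data W 7 K γ}
  {F : GenusFrame} {θu : ∀ n : ℕ, globalUnitsOf (F.layer n)} {d : GenusDatum F θu}

namespace KatoExpPadicDatum

/-- ★ **`KatoExpPadicDatum.ofLawsOfUnit` — the inhabitation constructor at a GENERAL ★-unit**: as `ofLaws`, but the `Λˣ`-normalisation of the
★-class is an ARGUMENT `uStar : Λˣ`, the datum's ★-class is `zStar := uStar⁻¹ • res zOne` (`uStar • zStar = res zOne` by `smul_inv_smul`), and the
7-adic ★-value law `hZ` is stated AT THAT `zStar`.  `ofLaws` is the special case `uStar = 1`.  A definition; the three laws are its only hypotheses.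
[cite: Kato2004Asterisque, Prop. 15.9 (15.9.1) (pp. 258–259), Thm. 12.5 (1) (p. 221), §13.9 (p. 230), (15.12.2) (p. 263), 15.14 (p. 264), (15.16.1) (p. 265)]
[cite: BlochKato1990, Def. 3.10 (p. 359)] [cite: Washington1997, §13.1 and Prop. 13.2] -/
def ofLawsOfUnit (hγ : K.IsTopGenerator γ) (Φ : PinnedKatoGenusFrame W K hK I d) (ι₇ : ℚ_[7] →+* ℂ)
    (h2 : Φ.ExpStarCMShape) (uStar : (IwasawaAlgebra 7)ˣ)
    (e : ℕ) (α₀ α₁ : ℤ_[7]) (hα : α₀ ≠ 0 ∨ α₁ ≠ 0) (n₀ : ℕ)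
    (hZ : ∀ (n : ℕ), n₀ ≤ n → ∀ (χ : absoluteGaloisGroup Φ.Kcm →ₜ* ℂˣ),
      (∀ σ ∈ Φ.towerK.layerSubgroup (n + 1), χ σ = 1) →
      IsPrimitiveRoot (((χ Φ.γK : ℂˣ)) : ℂ) (7 ^ (n + 1)) →
      ∀ Lf : ℂ → ℂ, CM.IsDepletedHeckeL Φ.ψ χ (7 * (7 * F.d)) Lf →
        (7 : ℂ) ^ e * Φ.valOf ι₇ χ (uStar⁻¹ • I.resOver Φ.IK hγ Φ.isTopGenerator_γK Φ.zOne) =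
          (ι₇ (α₀ : ℚ_[7]) + ι₇ (α₁ : ℚ_[7]) * Φ.ιC (algebraMap Φ.Kcm (AlgebraicClosure Φ.Kcm) Φ.sqrtNegSeven)) * Φ.Ω⁻¹ * Lf 1)
    (b₀ b₁ : Ideal (𝓞 Φ.Kcm) → ℤ)
    (hψ : ∀ (𝔟 : Ideal (𝓞 Φ.Kcm)), IsTwist 7 Φ.𝔣 𝔟 →
      2 * CM.heckeCharIdealValue Φ.ψ 𝔟 =
        (b₀ 𝔟 : ℂ) + (b₁ 𝔟 : ℂ) * Φ.ιC (algebraMap Φ.Kcm (AlgebraicClosure Φ.Kcm) Φ.sqrtNegSeven)) :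
    KatoExpPadicDatum hγ Φ where
  ι₇ := ι₇
  val := Φ.valOf ι₇
  val_T := fun χ hχ x => Φ.valOf_T_smul ι₇ χ hχ x
  val_C := fun χ _ c x => Φ.valOf_C_smul ι₇ χ c x
  val_piK := fun χ _ x => Φ.valOf_piK_of_expStarCM h2 ι₇ χ x
  val_euK := fun 𝔟 h𝔟 n χ hχ Lf hLf => Φ.valOf_euK ι₇ 𝔟 h𝔟 n χ hχ Lf hLf
  uStar := uStar
  zStar := uStar⁻¹ • I.resOver Φ.IK hγ Φ.isTopGenerator_γK Φ.zOne
  uStar_smul_zStar := smul_inv_smul uStar _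
  e := e
  α₀ := α₀
  α₁ := α₁
  α_ne_zero := hα
  n₀ := n₀
  val_zStar := hZ
  bCoef₀ := b₀
  bCoef₁ := b₁
  psi_eq := hψ
  artExp := ZpExtension.artinExponent Φ.towerK
  art := fun _ h𝔟 _ _ hm χ hχ =>
    ZpExtension.heckeIdealValue_eq_pow_of_isCoprime Φ.towerK Φ.isTopGenerator_γK χ hχ (ne_bot_of_isTwist h𝔟)
      (isCoprime_span_seven_of_isTwist h𝔟) hm

variable {hγ : K.IsTopGenerator γ} {Φ : PinnedKatoGenusFrame W K hK I d} {ι₇ : ℚ_[7] →+* ℂ}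
  {h2 : Φ.ExpStarCMShape} {uStar : (IwasawaAlgebra 7)ˣ} {e : ℕ} {α₀ α₁ : ℤ_[7]} {hα : α₀ ≠ 0 ∨ α₁ ≠ 0} {n₀ : ℕ}
  {hZ : ∀ (n : ℕ), n₀ ≤ n → ∀ (χ : absoluteGaloisGroup Φ.Kcm →ₜ* ℂˣ),
      (∀ σ ∈ Φ.towerK.layerSubgroup (n + 1), χ σ = 1) →
      IsPrimitiveRoot (((χ Φ.γK : ℂˣ)) : ℂ) (7 ^ (n + 1)) →
      ∀ Lf : ℂ → ℂ, CM.IsDepletedHeckeL Φ.ψ χ (7 * (7 * F.d)) Lf →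
        (7 : ℂ) ^ e * Φ.valOf ι₇ χ (uStar⁻¹ • I.resOver Φ.IK hγ Φ.isTopGenerator_γK Φ.zOne) =
          (ι₇ (α₀ : ℚ_[7]) + ι₇ (α₁ : ℚ_[7]) * Φ.ιC (algebraMap Φ.Kcm (AlgebraicClosure Φ.Kcm) Φ.sqrtNegSeven)) * Φ.Ω⁻¹ * Lf 1}
  {b₀ b₁ : Ideal (𝓞 Φ.Kcm) → ℤ}
  {hψ : ∀ (𝔟 : Ideal (𝓞 Φ.Kcm)), IsTwist 7 Φ.𝔣 𝔟 →
      2 * CM.heckeCharIdealValue Φ.ψ 𝔟 =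
        (b₀ 𝔟 : ℂ) + (b₁ 𝔟 : ℂ) * Φ.ιC (algebraMap Φ.Kcm (AlgebraicClosure Φ.Kcm) Φ.sqrtNegSeven)}

/-- Projection: `val = valOf Φ ι₇`. [cite: Kato2004Asterisque, Prop. 15.9 (p. 258)] -/
@[simp] theorem ofLawsOfUnit_val : (ofLawsOfUnit hγ Φ ι₇ h2 uStar e α₀ α₁ hα n₀ hZ b₀ b₁ hψ).val = Φ.valOf ι₇ := rfl

/-- Projection: `uStar`. [cite: Kato2004Asterisque, §13.9 (p. 230, «independent of the choices»)] -/
@[simp] theorem ofLawsOfUnit_uStar : (ofLawsOfUnit hγ Φ ι₇ h2 uStar e α₀ α₁ hα n₀ hZ b₀ b₁ hψ).uStar = uStar := rfl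

/-- Projection: `zStar = uStar⁻¹ • res zOne`. [cite: Kato2004Asterisque, Thm. 12.5 (1) (p. 221) and 15.14 (p. 264)] -/
@[simp] theorem ofLawsOfUnit_zStar :
    (ofLawsOfUnit hγ Φ ι₇ h2 uStar e α₀ α₁ hα n₀ hZ b₀ b₁ hψ).zStar = uStar⁻¹ • I.resOver Φ.IK hγ Φ.isTopGenerator_γK Φ.zOne := rfl

/-- Projections: `e`, `α₀`, `α₁`, `n₀`. [cite: Kato2004Asterisque, (15.16.1) (p. 265)] -/
theorem ofLawsOfUnit_e_α_n₀ :
    (ofLawsOfUnit hγ Φ ι₇ h2 uStar e α₀ α₁ hα n₀ hZ b₀ b₁ hψ).e = e ∧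
      (ofLawsOfUnit hγ Φ ι₇ h2 uStar e α₀ α₁ hα n₀ hZ b₀ b₁ hψ).α₀ = α₀ ∧
      (ofLawsOfUnit hγ Φ ι₇ h2 uStar e α₀ α₁ hα n₀ hZ b₀ b₁ hψ).α₁ = α₁ ∧
      (ofLawsOfUnit hγ Φ ι₇ h2 uStar e α₀ α₁ hα n₀ hZ b₀ b₁ hψ).n₀ = n₀ :=
  ⟨rfl, rfl, rfl, rfl⟩

/-- The period-position exponent `jα = v₇(α₀² + 7α₁²)` of the datum at a general ★-unit (the gauge-invariant quantity bounded by (S-★)).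
[cite: Kato2004Asterisque, (15.16.1) (p. 265) and Thm. 12.5 (1) (p. 221)] -/
theorem ofLawsOfUnit_jα : (ofLawsOfUnit hγ Φ ι₇ h2 uStar e α₀ α₁ hα n₀ hZ b₀ b₁ hψ).jα = (α₀ ^ 2 + 7 * α₁ ^ 2).valuation := rfl

/-- Projection: `artExp = artinExponent`. [cite: Kato2004Asterisque, (15.12.2) (p. 263)] -/
theorem ofLawsOfUnit_artExp :
    (ofLawsOfUnit hγ Φ ι₇ h2 uStar e α₀ α₁ hα n₀ hZ b₀ b₁ hψ).artExp = ZpExtension.artinExponent Φ.towerK := rfl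

end KatoExpPadicDatum

/-- ★ **(S-D) FROM THE LAWS UNDER `∃ uStar`** — the shape of record for touch (9) (pen D1108 (R1″) / D1110 (d)): the pinned frame admits a 7-adic
dual-exponential value datum as soon as (e2) in `𝔏`-form, (psiK), and the 7-adic ★-value law hold for SOME ★-unit `uStar ∈ Λˣ` and SOME constants
`(e, α₀, α₁, n₀)` with `α ≠ 0`, at `zStar := uStar⁻¹ • res zOne`. [cite: Kato2004Asterisque, Thm. 12.5 (1) (p. 221), §13.9 (p. 230), 15.14 (p. 264), (15.16.1) (p. 265)] -/
theorem katoExpPadicCompatShape_of_exists_unitLaws (hγ : K.IsTopGenerator γ) (Φ : PinnedKatoGenusFrame W K hK I d) (ι₇ : ℚ_[7] →+* ℂ)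
    (h2 : Φ.ExpStarCMShape)
    (hZ : ∃ (uStar : (IwasawaAlgebra 7)ˣ) (e : ℕ) (α₀ α₁ : ℤ_[7]) (_ : α₀ ≠ 0 ∨ α₁ ≠ 0) (n₀ : ℕ),
      ∀ (n : ℕ), n₀ ≤ n → ∀ (χ : absoluteGaloisGroup Φ.Kcm →ₜ* ℂˣ),
      (∀ σ ∈ Φ.towerK.layerSubgroup (n + 1), χ σ = 1) →
      IsPrimitiveRoot (((χ Φ.γK : ℂˣ)) : ℂ) (7 ^ (n + 1)) →
      ∀ Lf : ℂ → ℂ, CM.IsDepletedHeckeL Φ.ψ χ (7 * (7 * F.d)) Lf →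
        (7 : ℂ) ^ e * Φ.valOf ι₇ χ (uStar⁻¹ • I.resOver Φ.IK hγ Φ.isTopGenerator_γK Φ.zOne) =
          (ι₇ (α₀ : ℚ_[7]) + ι₇ (α₁ : ℚ_[7]) * Φ.ιC (algebraMap Φ.Kcm (AlgebraicClosure Φ.Kcm) Φ.sqrtNegSeven)) * Φ.Ω⁻¹ * Lf 1)
    (hψ : ∃ b₀ b₁ : Ideal (𝓞 Φ.Kcm) → ℤ, ∀ (𝔟 : Ideal (𝓞 Φ.Kcm)), IsTwist 7 Φ.𝔣 𝔟 →
      2 * CM.heckeCharIdealValue Φ.ψ 𝔟 =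
        (b₀ 𝔟 : ℂ) + (b₁ 𝔟 : ℂ) * Φ.ιC (algebraMap Φ.Kcm (AlgebraicClosure Φ.Kcm) Φ.sqrtNegSeven)) :
    Nonempty (KatoExpPadicDatum hγ Φ) := by
  obtain ⟨uStar, e, α₀, α₁, hα, n₀, hZ⟩ := hZ
  obtain ⟨b₀, b₁, hψ⟩ := hψ
  exact ⟨KatoExpPadicDatum.ofLawsOfUnit hγ Φ ι₇ h2 uStar e α₀ α₁ hα n₀ hZ b₀ b₁ hψ⟩

end Unit

end Summit.BirchSwinnertonDyer.Rank1Residual.Additive.GenusSeven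

end
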